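import Summits.PneNP.PneNP.Theorems.SoloInformedStreaming
import Literature.Computability.MetaComplexity.McKayMurrayWilliams2019.UniformStreamingFooling
import Literature.Computability.Complexity.CircuitCountingSharp
import Summits.PneNP.PneNP.Theorems.SoloInformedCaterpillar
import Mathlib.Analysis.SpecialFunctions.Exponential
import HarnessLib

/-!
# Solo (informed) — the first rung through the magnification door: `MCSP[n]` needs one-pass streaming space `log₂ N · log₂ log₂ N − O(log₂ N)`

McKay–Murray–Williams 2019, Thm. 1.3 (the tree's `thm13`, proved for honest `s` in
`UniformStreamingProofs.lean`; summit corollary `soloInformed_pneNP_of_streamingLowerBound_pow`):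
if for EVERY constant `c` the language `MCSP[n]` (truth tables of `n`-variable functions of
`B₂`-circuit complexity `≤ n`, length `N = 2ⁿ`) has no uniform one-pass streaming algorithm with
space and update time `(log₂ N)^c + c`, then `P ≠ NP`.  This file proves the conjuncts `c = 0, 1`
UNCONDITIONALLY and isolates what is left:

* `soloInformed_mcspSize_id_not_mem_USTREAM` — **the space lower bound**: if at a single
  `n ≥ 2¹⁵ + 2` the space bound satisfies `S(2ⁿ) ≤ n + 1` (more generally
  `soloInformed_mcspSize_id_not_mem_USTREAM_of_lt`: whenever
  `(S(2ⁿ)+1)·2^{S(2ⁿ)}·2n·(16(2n+1)²)ⁿ < (n−2)!²·n!`, i.e. `S(2ⁿ) < n log₂ n − O(n)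
  = log₂ N · log₂log₂ N − O(log₂ N)`), then `MCSP[n] ∉ USTREAM S T` for EVERY update time `T`;
* `soloInformed_streamingLowerBound_id_rung` — the conjuncts `c ≤ 1` of
  `StreamingLowerBound (fun n => n)`;
* `soloInformed_pneNP_of_streamingLowerBound_id_two_le` — **what remains**: the conjuncts
  `c ≥ 2` alone imply `PneNP`.

Method (the lever and its ceiling).  A FOOLING FAMILY inside `MCSP[n]`: for each permutation `π`
of `k+1 = n−2` of the variables the *alternating caterpillar*
`g_π = x_{π 0} ∧ (x_{π 1} ∨ (x_{π 2} ∧ (⋯ (x_{π k} ⋆ z))))` (`cat`, support file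
`SoloInformedCaterpillar.lean`), a read-once formula with
`k+1` gates; the `(n−2)!` words `tt(g_π) ++ tt(g_π)` are truth tables of `(k+3)`-variable functions
of circuit size `≤ k+1 ≤ n` (the tree's `ForrMem.truthTable_snoc`: the two halves of a truth table
are the two restrictions of the last variable), hence in `MCSP[n]`; distinct `π` give distinct `g_π`
(`cat_injective`: the head variable is detected by one evaluation, `cat_update_detect`).  A
one-pass algorithm that has read the first half `tt(g_π)` remembers only its state; by the tree's
state-counting lemma (`not_decides_of_fooling`, Arora–Barak Lemma 13.5 in one-way form) the number
of GOOD pairs `(π, π')` — those with `tt(g_π) ++ tt(g_{π'}) ∈ MCSP[n]` — is at least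
`(n−2)!² / ((S+1)2^S)`.  But a good pair's word is the truth table of a function of circuit size
`≤ n`, and by the SHARP circuit count (`card_circuitSizeOver_le_mul_factorial_le`, Jukna 2012
Lemma 1.12 with the `n!` of gate renamings) there are at most `2n(16(2n+1)²)ⁿ/n!` of those.
Comparing: `(S+1)·2^S ≥ (n−2)!²·n!/(2n(16(2n+1)²)ⁿ) = 2^{n log₂ n − O(n)}`.

Ceiling of the method (recorded in the solo programme's sharpest statement, §3(b)): the argument
is purely information-theoretic (it ignores the update time `T`), and `MCSP[n]` IS decidable by a
one-pass streaming algorithm with space `O(n log n)·poly` storing nothing but a compressed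
hypothesis — McKay–Murray–Williams 2019, p. 3: *"there is no information-theoretic barrier"* and
Thm. 1.2 (space `Õ(s)` with a `Σ₃` oracle).  So the conjuncts `c ≥ 2`, where the allowed space
`(log₂ N)^c ≥ n²` exceeds `n log₂ n`, cannot be reached by state counting: they are statements
about update TIME, and that is exactly the remaining content of `P ≠ NP` through this door.
-/

noncomputable section

namespace Summit.PneNP.PneNP.Theorems

open Finset
open scoped Nat
open Literature.Computability.Complexity Literature.Computability.MetaComplexity
open Literature.Computability.MetaComplexity.McKayMurrayWilliams2019

/-! ### Good pairs are few -/

section Family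

variable (k : ℕ)

open scoped Classical in
/-- **Good pairs are few**: a set of pairs `(π, π')` whose words `tt(g_π) ++ tt(g_{π'})` all lie in
`MCSP[n]` has at most as many elements as there are `(k+3)`-variable functions of circuit size
`≤ k + 3`. -/
theorem card_good_le (s : Finset (Equiv.Perm (Fin (k + 1)) × Equiv.Perm (Fin (k + 1))))
    (hs : ∀ p ∈ s, truthTable (gFun k p.1) ++ truthTable (gFun k p.2) ∈ MCSPSize (fun n => n)) :
    s.card ≤ (univ.filter fun F : (Fin (k + 3) → Bool) → Bool =>
      circuitSizeOver B2 F ≤ k + 3).card := by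
  let wordFn : Equiv.Perm (Fin (k + 1)) × Equiv.Perm (Fin (k + 1)) → (Fin (k + 3) → Bool) → Bool :=
    fun p => ofTruthTable (truthTable (gFun k p.1) ++ truthTable (gFun k p.2)) (length_word k p.1 p.2)
  refine card_le_card_of_injOn wordFn (fun p hp => ?_) (fun p _ q _ hpq => ?_)
  · -- good words are truth tables of small functions
    obtain ⟨n', f', hw, hc⟩ := hs p hp
    have hn' : n' = k + 3 := by
      have := congrArg List.length hw
      rw [length_word, length_truthTable] at this
      exact (Nat.pow_right_injective (le_refl 2) this).symm
    subst hn'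
    have hwf : wordFn p = f' := by
      apply truthTable_injective
      simp only [wordFn, truthTable_ofTruthTable]
      exact hw
    simp only [coe_filter, mem_univ, true_and, Set.mem_setOf_eq]
    rw [hwf]
    exact hc
  · -- the word determines the pair
    have h := congrArg truthTable hpq
    simp only [wordFn, truthTable_ofTruthTable] at h
    obtain ⟨h1, h2⟩ := List.append_inj h (by simp [length_truthTable])
    exact Prod.ext (gFun_injective k (truthTable_injective h1))
      (gFun_injective k (truthTable_injective h2))

end Family

/-! ### The space lower bound -/

/-- **`MCSP[n]` is not decided in small one-pass streaming space (raw form).** If at some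
`n ≥ 3` the space bound `S` at input length `N = 2ⁿ` satisfies
`(S N + 1) · 2^{S N} · (2n · (16 (2n+1)²)ⁿ) < (n−2)!² · n!`, then `MCSP[n] ∉ USTREAM S T`,
whatever the update time `T`. -/
theorem soloInformed_mcspSize_id_not_mem_USTREAM_of_lt (S T : ℕ → ℕ) (n : ℕ) (hn : 3 ≤ n)
    (h : (S (2 ^ n) + 1) * 2 ^ S (2 ^ n) * ((n + n) * (16 * (n + n + 1) ^ 2) ^ n) <
      (n - 2)! ^ 2 * n !) :
    MCSPSize (fun n => n) ∉ USTREAM S T := by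
  classical
  obtain ⟨k, rfl⟩ : ∃ k, n = k + 3 := ⟨n - 3, by omega⟩
  rintro ⟨A, -, hS, -, -, hD⟩
  have hk2 : k + 3 - 2 = k + 1 := by omega
  rw [hk2] at h
  refine not_decides_of_fooling A hS (ι := Equiv.Perm (Fin (k + 1))) (N := 2 ^ (k + 3))
    (fun π => truthTable (gFun k π)) (fun π => truthTable (gFun k π)) (length_word k)
    (diag_mem k) (B := (univ.filter fun F : (Fin (k + 3) → Bool) → Bool =>
      circuitSizeOver B2 F ≤ k + 3).card) (card_good_le k) ?_ hD
  -- the count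
  have hC := CircuitCount.card_circuitSizeOver_le_mul_factorial_le (k + 3) (k + 3)
  have hcard : Fintype.card (Equiv.Perm (Fin (k + 1))) = (k + 1)! := by
    rw [Fintype.card_perm, Fintype.card_fin]
  rw [hcard]
  by_contra hge
  rw [not_lt] at hge
  have := calc (k + 1)! ^ 2 * (k + 3)!
      ≤ (S (2 ^ (k + 3)) + 1) * 2 ^ S (2 ^ (k + 3)) * (univ.filter fun F : (Fin (k + 3) → Bool) → Bool =>
          circuitSizeOver B2 F ≤ k + 3).card * (k + 3)! := Nat.mul_le_mul_right _ hge
    _ = (S (2 ^ (k + 3)) + 1) * 2 ^ S (2 ^ (k + 3)) * ((univ.filter fun F : (Fin (k + 3) → Bool) → Bool =>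
          circuitSizeOver B2 F ≤ k + 3).card * (k + 3)!) := by ring
    _ ≤ (S (2 ^ (k + 3)) + 1) * 2 ^ S (2 ^ (k + 3)) * ((k + 3 + (k + 3)) * (16 * (k + 3 + (k + 3) + 1) ^ 2) ^ (k + 3)) :=
          Nat.mul_le_mul_left _ hC
  exact absurd h (not_lt.2 this)

/-! ### Numerics: `S(2ⁿ) ≤ n + 1` is small enough for `n ≥ 2¹⁵ + 2` -/

/-- `k^k ≤ k! · 3^k` (from `k^k / k! ≤ eᵏ` and `e < 3`). -/
theorem pow_self_le_factorial_mul_three_pow (k : ℕ) : k ^ k ≤ k ! * 3 ^ k := by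
  have h := Real.pow_div_factorial_le_exp (k : ℝ) (Nat.cast_nonneg k) k
  have hk : (0 : ℝ) < (k ! : ℝ) := by exact_mod_cast Nat.factorial_pos k
  rw [div_le_iff₀ hk] at h
  have he : Real.exp (k : ℝ) ≤ (3 : ℝ) ^ k := by
    have h1 : Real.exp (k : ℝ) = Real.exp 1 ^ k := by rw [← Real.exp_nat_mul, mul_one]
    have h3 : Real.exp 1 ≤ 3 := le_of_lt (lt_trans Real.exp_one_lt_d9 (by norm_num))
    rw [h1]
    gcongr
  have : ((k ^ k : ℕ) : ℝ) ≤ ((k ! * 3 ^ k : ℕ) : ℝ) := by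
    push_cast
    calc (k : ℝ) ^ k ≤ Real.exp k * k ! := h
      _ ≤ (3 : ℝ) ^ k * k ! := by gcongr
      _ = (k ! : ℝ) * 3 ^ k := mul_comm _ _
  exact_mod_cast this

/-- **The numerical comparison**: for `t ≥ 2¹⁵` and `S ≤ t + 3`,
`(S+1)·2^S·((2t+4)·(16(2t+5)²)^{t+2}) < t!²·(t+2)!`. -/
theorem numeric_bound (t : ℕ) (ht : 2 ^ 15 ≤ t) (S : ℕ) (hS : S ≤ t + 3) :
    (S + 1) * 2 ^ S * ((t + 2 + (t + 2)) * (16 * (t + 2 + (t + 2) + 1) ^ 2) ^ (t + 2)) <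
      t ! ^ 2 * (t + 2)! := by
  -- the denominators of the factorial lower bounds
  set D : ℕ := (3 ^ t) ^ 2 * 3 ^ (t + 2) with hD
  have hDpos : 0 < D := by positivity
  have hR : t ^ t * t ^ t * (t + 2) ^ (t + 2) ≤ t ! ^ 2 * (t + 2)! * D := by
    have h1 := pow_self_le_factorial_mul_three_pow t
    have h2 := pow_self_le_factorial_mul_three_pow (t + 2)
    calc t ^ t * t ^ t * (t + 2) ^ (t + 2)
        ≤ (t ! * 3 ^ t) * (t ! * 3 ^ t) * ((t + 2)! * 3 ^ (t + 2)) := by gcongr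
      _ = t ! ^ 2 * (t + 2)! * D := by rw [hD]; ring
  suffices hL : (S + 1) * 2 ^ S * ((t + 2 + (t + 2)) * (16 * (t + 2 + (t + 2) + 1) ^ 2) ^ (t + 2)) * D <
      t ^ t * t ^ t * (t + 2) ^ (t + 2) by
    exact Nat.lt_of_mul_lt_mul_right (lt_of_lt_of_le hL hR)
  -- termwise bounds
  have hS' : (S + 1) * 2 ^ S ≤ (t + 4) * 2 ^ (t + 3) :=
    Nat.mul_le_mul (by omega) (Nat.pow_le_pow_right (by norm_num) hS)
  have hsq : 16 * (t + 2 + (t + 2) + 1) ^ 2 ≤ 144 * (t + 2) ^ 2 := by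
    have : t + 2 + (t + 2) + 1 ≤ 3 * (t + 2) := by omega
    calc 16 * (t + 2 + (t + 2) + 1) ^ 2 ≤ 16 * (3 * (t + 2)) ^ 2 :=
          Nat.mul_le_mul_left _ (Nat.pow_le_pow_left this 2)
      _ = 144 * (t + 2) ^ 2 := by ring
  have ht2 : t + 2 ≤ 2 * t := by omega
  have hpoly : (t + 4) * (t + 2 + (t + 2)) ≤ 6 * t ^ 2 := by nlinarith
  -- the main chain
  have hmain : (S + 1) * 2 ^ S * ((t + 2 + (t + 2)) * (16 * (t + 2 + (t + 2) + 1) ^ 2) ^ (t + 2)) * D ≤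
      35831808 * (2 ^ (t * 2) * 3 ^ (t * 3) * 144 ^ t) * t ^ (t + 4) * (t + 2) ^ (t + 2) := by
    calc (S + 1) * 2 ^ S * ((t + 2 + (t + 2)) * (16 * (t + 2 + (t + 2) + 1) ^ 2) ^ (t + 2)) * D
        ≤ (t + 4) * 2 ^ (t + 3) * ((t + 2 + (t + 2)) * (144 * (t + 2) ^ 2) ^ (t + 2)) * D := by
          gcongr
      _ = (t + 4) * (t + 2 + (t + 2)) * (2 ^ (t + 3) * 144 ^ (t + 2) * D) *
            ((t + 2) ^ (t + 2) * (t + 2) ^ (t + 2)) := by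
          rw [mul_pow, ← pow_mul]; ring
      _ ≤ 6 * t ^ 2 * (2 ^ (t + 3) * 144 ^ (t + 2) * D) * ((2 * t) ^ (t + 2) * (t + 2) ^ (t + 2)) :=
          Nat.mul_le_mul (Nat.mul_le_mul_right _ hpoly)
            (Nat.mul_le_mul_right _ (Nat.pow_le_pow_left ht2 _))
      _ = 35831808 * (2 ^ (t * 2) * 3 ^ (t * 3) * 144 ^ t) * t ^ (t + 4) * (t + 2) ^ (t + 2) := by
          rw [hD]; ring
  refine lt_of_le_of_lt hmain ?_
  -- `35831808 · 15552ᵗ · t^{t+4} < t^{2t}`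
  have ht4 : 4 ≤ t := le_trans (by norm_num) ht
  have hsplit : t ^ t * t ^ t = t ^ (t + 4) * t ^ (t - 4) := by
    rw [← pow_add, ← pow_add]; congr 1; omega
  rw [hsplit]
  have hpos : 0 < t ^ (t + 4) * (t + 2) ^ (t + 2) := by positivity
  have h15552 : 2 ^ (t * 2) * 3 ^ (t * 3) * 144 ^ t = 15552 ^ t := by
    rw [pow_mul', pow_mul', ← mul_pow, ← mul_pow]; norm_num
  have hcore : 35831808 * (2 ^ (t * 2) * 3 ^ (t * 3) * 144 ^ t) < t ^ (t - 4) := by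
    rw [h15552]
    calc 35831808 * 15552 ^ t < 2 ^ 26 * (2 ^ 14) ^ t := by
          have h1 : 15552 ^ t ≤ (2 ^ 14) ^ t := Nat.pow_le_pow_left (by norm_num) t
          have h2 : 0 < (2 ^ 14) ^ t := by positivity
          calc 35831808 * 15552 ^ t ≤ 35831808 * (2 ^ 14) ^ t := Nat.mul_le_mul_left _ h1
            _ < 2 ^ 26 * (2 ^ 14) ^ t := Nat.mul_lt_mul_of_pos_right (by norm_num) h2
      _ = 2 ^ (26 + 14 * t) := by rw [pow_add, pow_mul]
      _ ≤ 2 ^ (15 * (t - 4)) := Nat.pow_le_pow_right (by norm_num) (by omega)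
      _ = (2 ^ 15) ^ (t - 4) := by rw [pow_mul]
      _ ≤ t ^ (t - 4) := Nat.pow_le_pow_left ht _
  calc 35831808 * (2 ^ (t * 2) * 3 ^ (t * 3) * 144 ^ t) * t ^ (t + 4) * (t + 2) ^ (t + 2)
      = 35831808 * (2 ^ (t * 2) * 3 ^ (t * 3) * 144 ^ t) * (t ^ (t + 4) * (t + 2) ^ (t + 2)) := by
        ring
    _ < t ^ (t - 4) * (t ^ (t + 4) * (t + 2) ^ (t + 2)) := Nat.mul_lt_mul_of_pos_right hcore hpos
    _ = t ^ (t + 4) * t ^ (t - 4) * (t + 2) ^ (t + 2) := by ring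

/-- **`MCSP[n]` needs one-pass streaming space more than `log₂ N + 1`** (indeed
`log₂ N · log₂ log₂ N − O(log₂ N)`, see `…_of_lt`): if `S(2ⁿ) ≤ n + 1` at a single `n ≥ 2¹⁵ + 2`
then `MCSP[n] ∉ USTREAM S T` for every update time `T`. -/
theorem soloInformed_mcspSize_id_not_mem_USTREAM (S T : ℕ → ℕ)
    (h : ∃ n, 2 ^ 15 + 2 ≤ n ∧ S (2 ^ n) ≤ n + 1) : MCSPSize (fun n => n) ∉ USTREAM S T := by
  obtain ⟨n, hn, hS⟩ := h
  obtain ⟨t, rfl⟩ : ∃ t, n = t + 2 := ⟨n - 2, by omega⟩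
  refine soloInformed_mcspSize_id_not_mem_USTREAM_of_lt S T (t + 2) (by omega) ?_
  have := numeric_bound t (by omega) (S (2 ^ (t + 2))) (by omega)
  simpa using this

/-! ### The rungs `c = 0, 1` of the streaming lower bound, and what remains -/

/-- **Rungs `c ≤ 1` of `StreamingLowerBound (fun n => n)`, unconditionally**: `MCSP[n]` has no
uniform one-pass streaming algorithm with space (and update time) `(log₂ N)^c + c` for `c ≤ 1`. -/
theorem soloInformed_streamingLowerBound_id_rung (c : ℕ) (hc : c ≤ 1) :
    MCSPSize (fun n => n) ∉
      USTREAM (fun N => Nat.log 2 N ^ c + c) (fun N => Nat.log 2 N ^ c + c) := by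
  apply soloInformed_mcspSize_id_not_mem_USTREAM
  refine ⟨2 ^ 15 + 2, le_rfl, ?_⟩
  rw [Nat.log_pow (by norm_num)]
  interval_cases c <;> simp

/-- **What remains through the door.** The conjuncts `c ≥ 2` of the McKay–Murray–Williams
streaming lower bound for `MCSP[n]` — no uniform one-pass streaming algorithm with space and
update time `(log₂ N)^c + c` — imply `PneNP`; the conjuncts `c ≤ 1` are theorems
(`soloInformed_streamingLowerBound_id_rung`). -/
theorem soloInformed_pneNP_of_streamingLowerBound_id_two_le
    (h : ∀ c : ℕ, 2 ≤ c → MCSPSize (fun n => n) ∉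
      USTREAM (fun N => Nat.log 2 N ^ c + c) (fun N => Nat.log 2 N ^ c + c)) : PneNP := by
  have hall : StreamingLowerBound (fun n => n ^ 1) := by
    intro c
    simp only [pow_one]
    by_cases hc : c ≤ 1
    · exact soloInformed_streamingLowerBound_id_rung c hc
    · exact h c (by omega)
  exact soloInformed_pneNP_of_streamingLowerBound_pow 1 le_rfl hall

end Summit.PneNP.PneNP.Theorems
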